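import Summits.BirchSwinnertonDyer.BirchSwinnertonDyer.Theorems.GoldfeldAllTwistsTwoConverseTwinAdditiveTwoPrimesTwistSelmerCount
import Summits.BirchSwinnertonDyer.BirchSwinnertonDyer.Theorems.GoldfeldAllTwistsTwoConverseTwinAdditiveTwoPrimesTwistSelmerDual
import HarnessLib

set_option linter.dupNamespace false -- namespace `…BirchSwinnertonDyer.BirchSwinnertonDyer…` is the cell's (D-0017 nested layout)
set_option autoImplicit false

/-!
# Twin″ (item 19140), cell C7 (p ≡ 1 (mod 8), type β), TRANCHE C7-3 file F9a: the `2`-adic kills of `S′ = S(84qp, −28q²p²)` for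
# `p ≡ 1 (mod 8)`, and the Selmer order `#S(−42qp, 448q²p²) ≤ 4` for `49a1^{(−2qp)}`

Cell `bsd-goldfeld`, seat `bsd-goldfeld-s1p-c3x` (gen 12); planner RULING (cccxxxviii) (3) «TRANCHE C7-3 (formula axis)», object F9, first file.
`--supports stmt-BirchSwinnertonDyer-19140` as a HELPER. FACT-FREE: no print binder, no definition, no `sorry`.

THE CELL C7: `q ≡ 7 (mod 8)` prime, `(q/7) = −1`; `p ≡ 1 (mod 8)` prime, `(−7/p) = +1` (and, on the dual side of file F9b, `−7` a fourth power
mod `p`); `(p/q) = −1`. The complete `2`-descent of `W = 49a1^{(−2qp)}` (model `E = ⟨0, −42qp, 0, 448q²p², 0⟩`, `E′ = ⟨0, 84qp, 0, −28q²p², 0⟩`)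
has `(#S, #S′) = (4, 4)` on C7 (kit j312848/j313281: `S = {1, 2, 7, 14}`, `S′ = {1, −7, −qp, 7qp}` on all 70 rows `qp ≤ 150000`), NOT the
`(2, 4)` of the cells C4 ∪ C6 ∪ C8 (`p ≡ 5 (mod 8)`, T3-D): `(2/p) = +1` lets `2, 14` into `S`, and `−qp, 7qp` into `S′`.

§1 `(2/p) = (7/p) = (−1/p) = +1` for `p ≡ 1 (mod 8)`, `(−7/p) = 1`.
§2 The `2`-adic kills of `S′` on C7. Since `p ≡ 1 (mod 8)` and `−q ≡ 1 (mod 8)` are squares in `ℚ₂`, the landed rescalings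
`isSoluble_two_of_common_factor` / `isSoluble_two_of_sq_factor` (`n ↦ n₀` with `n n₀ ∈ 1 + 8ℤ`: `p ↦ 1`, `q ↦ −1`) carry ALL FOUR classes
`2, −14, −2qp, 14qp` of `S′` to the single numeric quartic `w² = 2u⁴ − 84u²z² − 14z⁴`, which has no primitive `ℤ₂`-point: both charts die
modulo `2⁶` (`decide`; chart lemmas `not_isSoluble_two_of_padicInt_charts`, `padicInt_two_sq_ne_of_zmodPow` of `…TwinEvenTwistTwoAdic`).
§3 **`#S(−42qp, 448q²p²) ≤ 4`, `S ⊆ {1, 2, 7, 14}`** under `q ≡ 7 (mod 8)`, `(q/7) = −1`, `p ≡ 1 (mod 4)`, `(−7/p) = 1`, `(p/q) = −1` (no type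
condition, no `2`-adic work): negatives die at `ℝ`; the eight `q`-classes at `q` (`(−7/q) = −1`, part I's `not_isSoluble_padic_of_prime_dvd_coeffs`);
`p, 7p, 2p, 14p` at `q` (`(p/q) = (7p/q) = (2p/q) = (14p/q) = −1` as `(2/q) = (7/q) = +1`; part VIII's `not_isSoluble_padic_of_nonresidue_of_sq_dvd`),
word for word as T3-D part 2 (`card_twoIsogenySelmerGroup_twoPrimesTwist_le`) minus its two `p`-adic kills of `2, 14`.
HONEST FRAMING: local lemmas and a Selmer bound; no `BSD(W,2)` is proved; BSD is not proved by any of this; item 19140 stays open.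

References: [SilvermanAEC2009] Prop. X.4.9, Example X.4.10; [Serre1973] Ch. II §3.3 Thm 4; [Zywina2025] Lemma 3.1.
-/

noncomputable section

open scoped Classical

open WeierstrassCurve Literature.NumberTheory.EllipticCurves

namespace Summit.BirchSwinnertonDyer.BirchSwinnertonDyer.Theorems.GoldfeldGoodTwists

/-! ## §1 Residue symbols at `p ≡ 1 (mod 8)` -/

/-- `p ≡ 1 (8)`, `(−7/p) = 1` ⇒ `(2/p) = +1`, `(7/p) = +1`, `(−1/p) = +1`. [folklore] -/
theorem legendreSym_two_seven_neg_one_of_one_mod_eight {p : ℕ} [Fact p.Prime] (hp8 : p % 8 = 1) (hp7 : legendreSym p (-7) = 1) :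
    legendreSym p 2 = 1 ∧ legendreSym p 7 = 1 ∧ legendreSym p (-1) = 1 := by
  have hp2 : p ≠ 2 := by rintro rfl; norm_num at hp8
  have hp2' : p % 2 = 1 := by omega
  have h2 : legendreSym p 2 = 1 := by rw [legendreSym.at_two hp2, ZMod.χ₈_nat_eq_if_mod_eight]; simp [hp8, hp2']
  have hm1 : legendreSym p (-1) = 1 := by rw [legendreSym.at_neg_one hp2, ZMod.χ₄_nat_one_mod_four (by omega)]
  have h7 : legendreSym p 7 = 1 := by
    have hmul : legendreSym p (-7) = legendreSym p (-1) * legendreSym p 7 := by rw [← legendreSym.mul]; norm_num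
    rw [hmul, hm1, one_mul] at hp7; exact hp7
  exact ⟨h2, h7, hm1⟩

/-! ## §2 The `2`-adic kills of `S′ = S(84qp, −28q²p²)` for `p ≡ 1 (mod 8)`, `q ≡ 7 (mod 8)` -/

/-- `ℤ/2⁶` keys for `(−84; 2, −14)`: both charts die modulo `64`. [folklore] -/
private theorem keys_pOne :
    (∀ T S : ZMod (2 ^ 6), S ^ 2 ≠ ((2 : ℤ) : ZMod (2 ^ 6)) + ((-84 : ℤ) : ZMod (2 ^ 6)) * T ^ 2 +
      ((-14 : ℤ) : ZMod (2 ^ 6)) * T ^ 4) ∧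
    (∀ T S : ZMod (2 ^ 6), S ^ 2 ≠ ((-14 : ℤ) : ZMod (2 ^ 6)) + ((-84 : ℤ) : ZMod (2 ^ 6)) * T ^ 2 +
      ((2 : ℤ) : ZMod (2 ^ 6)) * T ^ 4) := by
  refine ⟨?_, ?_⟩ <;> decide +kernel

/-- **The C7-shape numeric kill**: `w² = 2u⁴ − 84u²z² − 14z⁴` has no non-trivial `ℚ₂`-point (`u` even ⇒ `w² ≡ 2 (16)`·unit; `u, z` odd ⇒
`w² ≡ 32 (mod 64)`; symmetrically in the other chart). [cite: SilvermanAEC2009, Prop. X.4.9 and Example X.4.10] -/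
theorem not_isSoluble_two_normalised_pOne : ¬ ((twoIsogenyQuartic (-84) 2 (-14)).map (Int.castRingHom ℚ_[2])).IsSoluble := by
  obtain ⟨c, c'⟩ := keys_pOne
  exact not_isSoluble_two_of_padicInt_charts (padicInt_two_sq_ne_of_zmodPow 6 c) (padicInt_two_sq_ne_of_zmodPow 6 c')

section Classes
variable {q p : ℕ}

/-- Engine, common-factor type: `d = pq·d₁`, `d′ = pq·e₁` ⇒ after `p ↦ 1` (`p ≡ 1 (8)`) and `q ↦ −1` (`q ≡ 7 (8)`) the class is the numeric
quartic `(−84; −d₁, −e₁)`. [cite: Serre1973, Ch. II §3.3 Thm 4] -/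
private theorem kill_common_pOne (hq8 : q % 8 = 7) (hp8 : p % 8 = 1) {a d d' d₁ e₁ : ℤ}
    (ha : a = 84 * ((q : ℤ) * p)) (hd : d = p * (q * d₁)) (hd' : d' = p * (q * e₁))
    (hk : ¬ ((twoIsogenyQuartic (-1 * 84) (-1 * d₁) (-1 * e₁)).map (Int.castRingHom ℚ_[2])).IsSoluble) :
    ¬ ((twoIsogenyQuartic a d d').map (Int.castRingHom ℚ_[2])).IsSoluble := fun h ↦ by
  have h1 := isSoluble_two_of_common_factor (n := p) (n₀ := 1) (by omega) (a₀ := 84 * q) (d₀ := q * d₁) (e₀ := q * e₁)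
    (by rw [ha]; ring) hd hd' h
  exact hk (isSoluble_two_of_common_factor (n := q) (n₀ := -1) (by omega) (a₀ := 84) (d₀ := d₁) (e₀ := e₁) (by ring) (by ring)
    (by ring) h1)

/-- Engine, square-factor type: `d` prime to `qp`, `d′ = p²q²·e₁` ⇒ after `p ↦ 1`, `q ↦ −1` the class is the numeric quartic `(−84; d, e₁)`.
[cite: Serre1973, Ch. II §3.3 Thm 4] -/
private theorem kill_sq_pOne (hq8 : q % 8 = 7) (hp8 : p % 8 = 1) {a d d' e₁ : ℤ}
    (ha : a = 84 * ((q : ℤ) * p)) (hd' : d' = e₁ * ((q : ℤ) * p) ^ 2)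
    (hk : ¬ ((twoIsogenyQuartic (-1 * 84) d ((-1) ^ 2 * e₁)).map (Int.castRingHom ℚ_[2])).IsSoluble) :
    ¬ ((twoIsogenyQuartic a d d').map (Int.castRingHom ℚ_[2])).IsSoluble := fun h ↦ by
  have h1 := isSoluble_two_of_sq_factor (n := p) (n₀ := 1) (by omega) (a₁ := 84 * q) (e₁ := q ^ 2 * e₁) (by rw [ha]; ring)
    (by rw [hd']; ring) h
  exact hk (isSoluble_two_of_sq_factor (n := q) (n₀ := -1) (by omega) (a₁ := 84) (e₁ := e₁) (by ring) (by ring) h1)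

/-- **Class `2` of `S′`** (`d′ = −14q²p²`), C7: no `ℚ₂`-point. [cite: SilvermanAEC2009, Prop. X.4.9 and Example X.4.10] -/
theorem not_isSoluble_two_dual_two_pOne (hq8 : q % 8 = 7) (hp8 : p % 8 = 1) {a d d' : ℤ} (ha : a = 84 * ((q : ℤ) * p))
    (hd : d = 2) (hd' : d' = -14 * ((q : ℤ) * p) ^ 2) : ¬ ((twoIsogenyQuartic a d d').map (Int.castRingHom ℚ_[2])).IsSoluble := by
  subst hd
  exact kill_sq_pOne hq8 hp8 ha (e₁ := -14) (by rw [hd']) (by norm_num; exact not_isSoluble_two_normalised_pOne)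

/-- **Class `−14` of `S′`** (`d′ = 2q²p²`), C7: no `ℚ₂`-point. [cite: SilvermanAEC2009, Prop. X.4.9 and Example X.4.10] -/
theorem not_isSoluble_two_dual_negFourteen_pOne (hq8 : q % 8 = 7) (hp8 : p % 8 = 1) {a d d' : ℤ} (ha : a = 84 * ((q : ℤ) * p))
    (hd : d = -14) (hd' : d' = 2 * ((q : ℤ) * p) ^ 2) : ¬ ((twoIsogenyQuartic a d d').map (Int.castRingHom ℚ_[2])).IsSoluble := by
  subst hd
  exact kill_sq_pOne hq8 hp8 ha (e₁ := 2) (by rw [hd'])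
    (by norm_num; rw [isSoluble_map_twoIsogenyQuartic_comm]; exact not_isSoluble_two_normalised_pOne)

/-- **Class `−2qp` of `S′`** (`d′ = 14qp`), C7: no `ℚ₂`-point. [cite: SilvermanAEC2009, Prop. X.4.9 and Example X.4.10] -/
theorem not_isSoluble_two_dual_negTwoQP_pOne (hq8 : q % 8 = 7) (hp8 : p % 8 = 1) {a d d' : ℤ} (ha : a = 84 * ((q : ℤ) * p))
    (hd : d = -2 * ((q : ℤ) * p)) (hd' : d' = 14 * ((q : ℤ) * p)) :
    ¬ ((twoIsogenyQuartic a d d').map (Int.castRingHom ℚ_[2])).IsSoluble :=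
  kill_common_pOne hq8 hp8 ha (d₁ := -2) (e₁ := 14) (by rw [hd]; ring) (by rw [hd']; ring)
    (by norm_num; exact not_isSoluble_two_normalised_pOne)

/-- **Class `14qp` of `S′`** (`d′ = −2qp`), C7: no `ℚ₂`-point. [cite: SilvermanAEC2009, Prop. X.4.9 and Example X.4.10] -/
theorem not_isSoluble_two_dual_fourteenQP_pOne (hq8 : q % 8 = 7) (hp8 : p % 8 = 1) {a d d' : ℤ} (ha : a = 84 * ((q : ℤ) * p))
    (hd : d = 14 * ((q : ℤ) * p)) (hd' : d' = -2 * ((q : ℤ) * p)) :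
    ¬ ((twoIsogenyQuartic a d d').map (Int.castRingHom ℚ_[2])).IsSoluble := by
  rw [isSoluble_map_twoIsogenyQuartic_comm]
  exact not_isSoluble_two_dual_negTwoQP_pOne hq8 hp8 ha hd' hd

end Classes

/-! ## §3 `#S(−42qp, 448q²p²) ≤ 4` on C7 (and on every `p ≡ 1 (mod 4)`): `S ⊆ {1, 2, 7, 14}` -/

section SelmerS
variable {q p : ℕ} [Fact q.Prime] [Fact p.Prime]

/-- A natural number not divisible by the prime `ℓ` is non-zero in `ZMod ℓ`, as an integer cast. [folklore] -/
private theorem intCast_ne_zero_of_not_dvd_pOne {l : ℕ} [Fact l.Prime] {n : ℕ} (h : ¬ l ∣ n) : ((n : ℤ) : ZMod l) ≠ 0 := by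
  rw [Int.cast_natCast, Ne, ZMod.natCast_eq_zero_iff]; exact h

/-- A prime `ℓ ≠ 2, 7` divides no `2^a·7^b`. [folklore] -/
private theorem not_dvd_two_pow_mul_seven_pow_pOne {l : ℕ} (hl : l.Prime) (hl2 : l ≠ 2) (hl7 : l ≠ 7) (a b : ℕ) :
    ¬ l ∣ 2 ^ a * 7 ^ b := by
  intro h
  rcases (Nat.Prime.dvd_mul hl).mp h with h | h
  · exact hl2 ((Nat.prime_dvd_prime_iff_eq hl Nat.prime_two).mp (hl.dvd_of_dvd_pow h))
  · exact hl7 ((Nat.prime_dvd_prime_iff_eq hl (by norm_num)).mp (hl.dvd_of_dvd_pow h))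

set_option maxHeartbeats 400000 in -- sixteen positive classes, each with its local computation
/-- **`S(−42qp, 448q²p²) ⊆ {1, 2, 7, 14}`** for `q ≡ 7 (8)`, `(q/7) = −1`, `p ≡ 1 (4)`, `(−7/p) = 1`, `(p/q) = −1` (cell C7 included): negatives at
`ℝ`, the `q`-classes at `q`, `p, 2p, 7p, 14p` at `q`. [cite: SilvermanAEC2009, Prop. X.4.9 and Example X.4.10] -/
theorem twoIsogenySelmerGroup_twoPrimesTwist_subset_pOne (hq8 : q % 8 = 7) (hq7 : jacobiSym q 7 = -1) (hp4 : p % 4 = 1)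
    (hp7 : legendreSym p (-7) = 1) (hpq : jacobiSym p q = -1) :
    twoIsogenySelmerGroup (-42 * ((q : ℤ) * p)) (448 * ((q : ℤ) * p) ^ 2) ⊆ ({1, 2, 7, 14} : Finset ℤ) := by
  have hq : q.Prime := Fact.out
  have hp : p.Prime := Fact.out
  have hqZ : Prime (q : ℤ) := Nat.prime_iff_prime_int.mp hq
  have hpZ : Prime (p : ℤ) := Nat.prime_iff_prime_int.mp hp
  have hq0 : (q : ℤ) ≠ 0 := by exact_mod_cast hq.ne_zero
  have hp0 : (p : ℤ) ≠ 0 := by exact_mod_cast hp.ne_zero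
  have hq4 : q % 4 = 3 := by omega
  have hq2 : q ≠ 2 := by rintro rfl; norm_num at hq4
  have hp2 : p ≠ 2 := by rintro rfl; norm_num at hp4
  have hqp : q ≠ p := by rintro rfl; omega
  have hq7' : q ≠ 7 := by
    rintro rfl; rw [jacobiSym.mod_left] at hq7; norm_num at hq7
  have hp7' : p ≠ 7 := by rintro rfl; norm_num at hp4
  obtain ⟨h7q, hm7q⟩ := legendreSym_seven_and_neg_seven_of_three_mod_four hq4 hq7
  have h2q : legendreSym q 2 = 1 := by
    rw [legendreSym.at_two hq2, ZMod.χ₈_nat_eq_if_mod_eight]; simp [hq8, show q % 2 = 1 by omega]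
  obtain ⟨-, hpq_q⟩ := legendreSym_swap_of_one_mod_four (q := q) (p := p) hp4 hqp hq2 hpq
  -- non-vanishing modulo `q`
  have hpq0 : (p : ZMod q) ≠ 0 := by
    have := intCast_ne_zero_of_not_dvd_pOne (l := q) (fun h ↦ hqp ((Nat.prime_dvd_prime_iff_eq hq hp).mp h)); exact_mod_cast this
  have hcq : ∀ a b : ℕ, (((2 ^ a * 7 ^ b : ℕ) : ℤ) : ZMod q) ≠ 0 := fun a b ↦
    intCast_ne_zero_of_not_dvd_pOne (not_dvd_two_pow_mul_seven_pow_pOne hq hq2 hq7' a b)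
  have h8q : ((8 : ℤ) : ZMod q) ≠ 0 := by have := hcq 3 0; norm_num at this; exact_mod_cast this
  have h4q : ((4 : ℤ) : ZMod q) ≠ 0 := by have := hcq 2 0; norm_num at this; exact_mod_cast this
  have h2pq : ((2 * p : ℤ) : ZMod q) ≠ 0 := by
    have h2 := hcq 1 0; norm_num at h2; push_cast; exact mul_ne_zero (by exact_mod_cast h2) hpq0
  -- the non-residues modulo `q`: `p, 7p, 2p, 14p` and their cofactors
  have hns_p_q : ¬ IsSquare (((p : ℤ)) : ZMod q) := (legendreSym.eq_neg_one_iff q).mp hpq_q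
  have hns_7p_q : ¬ IsSquare (((7 * p : ℤ)) : ZMod q) :=
    (legendreSym.eq_neg_one_iff q).mp (by rw [legendreSym.mul, h7q, hpq_q]; norm_num)
  have hns_p2_q : ¬ IsSquare ((((p : ℤ) * 2 : ℤ)) : ZMod q) :=
    (legendreSym.eq_neg_one_iff q).mp (by rw [legendreSym.mul, hpq_q, h2q]; norm_num)
  have hns_p14_q : ¬ IsSquare ((((p : ℤ) * 14 : ℤ)) : ZMod q) :=
    (legendreSym.eq_neg_one_iff q).mp (by
      rw [show ((p : ℤ) * 14 : ℤ) = p * 7 * 2 by ring, legendreSym.mul, legendreSym.mul, hpq_q, h7q, h2q]; norm_num)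
  have hns_448p_q : ¬ IsSquare (((448 * p : ℤ)) : ZMod q) := by
    rw [show (448 * p : ℤ) = 7 * p * 8 ^ 2 by ring]; exact not_isSquare_mul_sq_zmod h8q hns_7p_q
  have hns_64p_q : ¬ IsSquare (((64 * p : ℤ)) : ZMod q) := by
    rw [show (64 * p : ℤ) = p * 8 ^ 2 by ring]; exact not_isSquare_mul_sq_zmod h8q hns_p_q
  have hns_224p_q : ¬ IsSquare (((224 * p : ℤ)) : ZMod q) := by
    have h14p : ¬ IsSquare (((7 * p * 2 : ℤ)) : ZMod q) :=
      (legendreSym.eq_neg_one_iff q).mp (by rw [legendreSym.mul, legendreSym.mul, h7q, hpq_q, h2q]; norm_num)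
    rw [show (224 * p : ℤ) = 7 * p * 2 * 4 ^ 2 by ring]; exact not_isSquare_mul_sq_zmod h4q h14p
  have hns_32p_q : ¬ IsSquare (((32 * p : ℤ)) : ZMod q) := by
    rw [show (32 * p : ℤ) = p * 2 * 4 ^ 2 by ring]; exact not_isSquare_mul_sq_zmod h4q hns_p2_q
  have hns_disc_q : ¬ IsSquare ((((-42 * p) ^ 2 - 4 * (448 * p ^ 2) : ℤ)) : ZMod q) := by
    rw [show ((-42 * p) ^ 2 - 4 * (448 * p ^ 2) : ℤ) = -7 * (2 * p) ^ 2 by ring]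
    exact not_isSquare_mul_sq_zmod h2pq ((legendreSym.eq_neg_one_iff q).mp hm7q)
  have hb : (448 * ((q : ℤ) * p) ^ 2 : ℤ) ≠ 0 := by positivity
  intro d hd
  rw [mem_twoIsogenySelmerGroup_iff hb] at hd
  obtain ⟨hsqf, ⟨d', hdd'⟩, hloc⟩ := hd
  have hd'eq : (448 * ((q : ℤ) * p) ^ 2 : ℤ) / d = d' := by rw [hdd', Int.mul_ediv_cancel_left _ hsqf.ne_zero]
  rw [hd'eq] at hloc
  obtain ⟨hreal, hpadic⟩ := hloc
  -- negatives die at `ℝ`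
  have hdpos : 0 < d := by
    rcases lt_or_gt_of_ne hsqf.ne_zero with hneg | hpos
    · exfalso
      have hbpos : (0 : ℤ) < 448 * ((q : ℤ) * p) ^ 2 := by positivity
      have hd'neg : d' < 0 := by
        by_contra hcon
        nlinarith [mul_nonpos_iff.mpr (Or.inr ⟨hneg.le, le_of_not_gt hcon⟩)]
      have ha : (-42 * ((q : ℤ) * p)) ≤ 0 := by
        have : (0 : ℤ) ≤ (q : ℤ) * p := by positivity
        linarith
      exact not_isSoluble_real_twoIsogenyQuartic_of_neg hneg hd'neg ha hreal
    · exact hpos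
  -- the `q`-classes die at `q`
  have hqd : ¬ (q : ℤ) ∣ d := by
    rintro ⟨e, rfl⟩
    have h1 : e * d' = 448 * q * p ^ 2 := mul_left_cancel₀ hq0 (by linear_combination (-1 : ℤ) * hdd')
    have h3 : (q : ℤ) ∣ e * d' := ⟨448 * p ^ 2, by rw [h1]; ring⟩
    rcases hqZ.dvd_or_dvd h3 with h4 | h4
    · obtain ⟨e₁, rfl⟩ := h4
      exact hqZ.not_unit (hsqf (q : ℤ) ⟨e₁, by ring⟩)
    · obtain ⟨e', rfl⟩ := h4
      have hm : e * e' = 448 * p ^ 2 := mul_left_cancel₀ hq0 (by linear_combination h1)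
      exact not_isSoluble_padic_of_prime_dvd_coeffs (p := q) (c := -42 * p) (by ring) rfl rfl hm hns_disc_q (hpadic q)
  -- `d ∣ 14qp` prime to `q`: `d ∣ 14p`
  have h0 : d ∣ 448 * ((q : ℤ) * p) ^ 2 := ⟨d', hdd'⟩
  have h1 : d ∣ (14 * ((q : ℤ) * p)) ^ 6 := h0.trans ⟨16807 * ((q : ℤ) * p) ^ 4, by ring⟩
  have h14qp : d ∣ 14 * ((q : ℤ) * p) := (hsqf.dvd_pow_iff_dvd (by norm_num)).mp h1
  have hcopq : IsCoprime d (q : ℤ) := ((hqZ.irreducible.coprime_iff_not_dvd).mpr hqd).symm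
  have h14p : d ∣ 14 * (p : ℤ) := by
    have : d ∣ (q : ℤ) * (14 * p) := by rw [show (q : ℤ) * (14 * p) = 14 * (q * p) by ring]; exact h14qp
    exact hcopq.dvd_of_dvd_mul_left this
  by_cases hpd : (p : ℤ) ∣ d
  · -- `d = p·e`, `e ∣ 14`: all four die at `q`
    exfalso
    obtain ⟨e, rfl⟩ := hpd
    have he14 : e ∣ 14 := by
      have : (p : ℤ) * e ∣ (p : ℤ) * 14 := by rw [mul_comm (p : ℤ) 14]; exact h14p
      exact (mul_dvd_mul_iff_left hp0).mp this
    have hepos : 0 < e := pos_of_mul_pos_right hdpos (by positivity)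
    have hele : e ≤ 14 := Int.le_of_dvd (by norm_num) he14
    have hd'e : e * d' = 448 * q ^ 2 * p := mul_left_cancel₀ hp0 (by linear_combination (-1 : ℤ) * hdd')
    interval_cases e <;> try omega
    · -- `d = p`: `d′ = q²·448p`
      exact not_isSoluble_padic_of_nonresidue_of_sq_dvd (p := q) (c := -42 * p) (e' := 448 * p) (by ring)
        (show d' = (q : ℤ) ^ 2 * (448 * p) by linarith) (by simpa using hns_p_q) hns_448p_q (hpadic q)
    · -- `d = 2p`: `d′ = q²·224p`
      exact not_isSoluble_padic_of_nonresidue_of_sq_dvd (p := q) (c := -42 * p) (e' := 224 * p) (by ring)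
        (show d' = (q : ℤ) ^ 2 * (224 * p) by linarith)
        (by rw [show ((p : ℤ) * 2 : ℤ) = (p * 2 : ℤ) from rfl] at hns_p2_q; exact hns_p2_q) hns_224p_q (hpadic q)
    · -- `d = 7p`: `d′ = q²·64p`
      exact not_isSoluble_padic_of_nonresidue_of_sq_dvd (p := q) (c := -42 * p) (e' := 64 * p) (by ring)
        (show d' = (q : ℤ) ^ 2 * (64 * p) by linarith)
        (by rw [show ((p : ℤ) * 7 : ℤ) = (7 * p : ℤ) by ring]; exact hns_7p_q) hns_64p_q (hpadic q)
    · -- `d = 14p`: `d′ = q²·32p`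
      exact not_isSoluble_padic_of_nonresidue_of_sq_dvd (p := q) (c := -42 * p) (e' := 32 * p) (by ring)
        (show d' = (q : ℤ) ^ 2 * (32 * p) by linarith) hns_p14_q hns_32p_q (hpadic q)
  · -- `d ∣ 14`, `d > 0`
    have hcopp : IsCoprime d (p : ℤ) := ((hpZ.irreducible.coprime_iff_not_dvd).mpr hpd).symm
    have hd14 : d ∣ 14 := hcopp.dvd_of_dvd_mul_right h14p
    have hle : d ≤ 14 := Int.le_of_dvd (by norm_num) hd14
    interval_cases d <;> first | (exfalso; omega) | simp

/-- **`#S(−42qp, 448q²p²) ≤ 4`** for `q ≡ 7 (8)`, `(q/7) = −1`, `p ≡ 1 (4)`, `(−7/p) = 1`, `(p/q) = −1` (cell C7 included; sharp there by the kit).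
[cite: SilvermanAEC2009, Prop. X.4.9 and Example X.4.10] -/
theorem card_twoIsogenySelmerGroup_twoPrimesTwist_le_four_pOne (hq8 : q % 8 = 7) (hq7 : jacobiSym q 7 = -1) (hp4 : p % 4 = 1)
    (hp7 : legendreSym p (-7) = 1) (hpq : jacobiSym p q = -1) :
    (twoIsogenySelmerGroup (-42 * ((q : ℤ) * p)) (448 * ((q : ℤ) * p) ^ 2)).card ≤ 4 :=
  (Finset.card_le_card (twoIsogenySelmerGroup_twoPrimesTwist_subset_pOne hq8 hq7 hp4 hp7 hpq)).trans Finset.card_le_four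

end SelmerS

end Summit.BirchSwinnertonDyer.BirchSwinnertonDyer.Theorems.GoldfeldGoodTwists

end
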